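import Summits.NavierStokesRegularity.NavierStokesRegularity.Theses.TypeILiouville
import Summits.NavierStokesRegularity.NavierStokesRegularity.Theses.SqueezeCycle
import Summits.NavierStokesRegularity.NavierStokesRegularity.Theses.TypeICertificateLadder
import Summits.NavierStokesRegularity.NavierStokesRegularity.Theorems.TypeIliouvilleNoTypeII.Negative.WithoutLerayHopfFalse
import Summits.NavierStokesRegularity.NavierStokesRegularity.Theorems.TypeIliouvilleNoTypeII.Negative.RateTightness
import Literature.Analysis.FluidPDE.Axisymmetric
import Literature.Analysis.FluidPDE.NSCriticalClosureBesovBounded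
import Literature.Analysis.FluidPDE.TaoLocalisationHolds
import Literature.Analysis.FluidPDE.KNSSTypeII

/-!
# Disproof work file — crux `TypeIliouvilleNoTypeII` (item stmt-NavierStokesRegularity-0056)

The crux (route `TypeILiouville`, rank 2; verbatim `NoTypeII` in `SqueezeCycle`,
`TypeICertificateLadder` and eleven further routes — the same term, `Iff.rfl` in §0):

  `∀ ν T > 0, ∀ u p, IsMaximalSmoothSolution ν 0 u p T → IsLerayHopfOn T ν 0 (u 0) u →
     HasRapidSpatialDecay (u 0) → IsTypeIBlowup u T`

"every finite-energy classical solution from a rapidly decaying datum whose classical lifespan `T`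
is finite blows up at most at the self-similar rate `‖u(t)‖_∞ ≤ C (T − t)^{-1/2}`".

## Findings (cdisprove, cycle 1) — LANDED: `Theorems/TypeIliouvilleNoTypeII/Negative/`
`WithoutLerayHopfFalse.lean` (p136424, accepted) and `RateTightness.lean` (p136475, accepted);
this file imports them and keeps only the named statements, the conditional kill §c and the notes.

* **No junk model.** The hypotheses describe an honest object: by the tree theorems
  `exists_singularPoint_of_classical_of_not_hasSmoothExtensionPast` (Lemarié-Rieusset 2016,
  Thm 15.1 (C)) and `exists_forall_norm_le_of_tao2011` (Tao 2013, Cor. 11.1), a maximal classical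
  Leray–Hopf solution from a rapidly decaying datum is bounded on every closed sub-slab
  `[0, T₁] × ℝ³`, `T₁ < T`, and carries a CKN-singular point `(T, x₀)`; weak–strong uniqueness
  (`weak_strong_uniqueness_holds`) identifies it with the mild solution.  Hence a counterexample is
  EXACTLY a finite-energy Type II singularity from Schwartz data, i.e. a negative answer to Clay (A)
  (`not_noTypeII_iff_exists_isTypeIIBlowup`, Theorems/TypeICertificateLadderNoTypeIIBridge), and
  conversely Clay (A) makes the crux vacuously true.  No unconditional refutation short of ¬Clay (A).
* **(a) Load-bearing: finite energy** (landed).  With `IsLerayHopfOn` deleted the statement is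
  FALSE (`typeIliouvilleNoTypeII_false_without_lerayHopf`): the pressure-driven drift
  `u = g(t)·e₁`, `p = −g′(t) x₁`, `g(t) = (1 − t)⁻¹ − 1` (KNSS 2009, §1 p. 3, "parasitic solutions")
  is classical on `[0,1) × ℝ³` from the datum `0`, admits no classical extension past `1`, and has
  `√(1 − t)‖u(t)‖ = t/√(1 − t) → ∞`.  Any proof must use the energy class.  `0 < T` is REDUNDANT
  (`pos_of_isMaximalSmoothSolution`).  `0 < ν`, maximality, decay of the datum: no cheap witness
  exists (Notes).
* **(b) Tightness of the exponent `1/2`** (landed).  `NoBlowupRate α` (conclusion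
  `‖u(t, x)‖ ≤ C (T − t)^{-α}` eventually) is monotone in `α`; `α = 1/2` is the crux; for
  `α < 1/2` it is EQUIVALENT to `NoBlowup` (= the route's thesis X, `noBlowup_iff_thesis`) by the
  tree's `typeICertificateLadder_rungZero` (Leray's lower rate).  So `1/2` is the least exponent at
  which the crux is not already Clay (A) for blow-up times; rate-improving strategies prove
  regularity outright.  The Type-I bound on ALL of `[0, T)` is equivalent to the eventual one
  (`noTypeII_iff_allTimes`): that strengthening is harmless.  (Small constants `C < c√ν` are excluded
  by `typeICertificateLadder_rungZero` itself.)
* **(c) Conditional kill (the route's cheapest falsifier, typed; NOT landed on purpose).**  ONE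
  axisymmetric finite-energy blow-up from Schwartz data refutes the crux, given the Literature fact
  `knss_no_axisymmetric_typeI` (KNSS 2009 Thms 6.1–6.2 / Seregin–Šverák 2009 Thm 1.1; a `Prop` of
  `Literature/Analysis/FluidPDE/Axisymmetric.lean`, not yet discharged):
  `typeIliouvilleNoTypeII_false_of_axisymmetricBlowup`.  Hou 2022 (arXiv:2107.06509), if singular,
  is such a blow-up.  Not filed as a proposal: a landed `H → ¬crux` would hold the 14-route item on an
  OPEN scenario (the hypothesis is ¬Clay (A)-hard, not a missing construction).
* **Barriers / negatives used.** `Literature/Barriers/NavierStokesRegularity/`: `TaoAveragedBlowup`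
  (Tao's averaged blow-up is Type II, arXiv:1402.0290 p. 8 fn.: an averaging-blind proof of the crux
  is impossible), `TruncatedDyadicBlowup.critical_blowup` (model blow-up is Type II),
  `AxisymmetricTypeIExclusion` (= §c), `EnergySupercriticality`.  `ledger negatives` (4 entries):
  none concerns blow-up rates of NS itself; but `PerpetualPump.Thesis` is REFUTED in the tree
  (`Theorems/PerpetualPumpThesisRefutation.lean`: an averaged equation of Tao's class with a TYPE-I
  blow-up from Schwartz data) — so over the averaging class BOTH halves of the Type-I/II programme
  fail abstractly ((L)-type Type-I exclusion by the perpetual pump, NoTypeII by Tao 2016).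
* **Print (searched 2026-08-17; OpenAlex/arXiv/S2 rate-limited, zbMATH ok):** newest is Seregin,
  arXiv:2606.29468 (2026), Thm 2.1 — exclusion of particular SCENARIOS of Type II blow-up
  (log-corrected rates `|v| ≲ ln^γ(e/√−t)/√−t` under generalised Morrey bounds (1.7)); no general
  exclusion and no construction exists.  Hu–Zhang arXiv:2510.25448 (Type I ⇒ ε-regularity criteria).

Everything here is sorry-free.  Sections: §0 probes · §a load-bearing · §b tightness ·
§c conditional kill · Notes (why it resists; targets for later cycles).
-/

noncomputable section

namespace Summit.NavierStokesRegularity.NavierStokesRegularity.Cruxes.TypeIliouvilleNoTypeII.Disproof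

set_option linter.dupNamespace false

open Set Filter Topology MeasureTheory Function
open scoped InnerProductSpace RealInnerProductSpace ContDiff
open Literature.Analysis.FluidPDE
open Summit.NavierStokesRegularity.NavierStokesRegularity.Theses
open Summit.NavierStokesRegularity.NavierStokesRegularity.Theorems
open Summit.NavierStokesRegularity.NavierStokesRegularity.Theorems.RungReynoldsOneNegative
open Summit.NavierStokesRegularity.NavierStokesRegularity.Theorems.TypeIliouvilleNoTypeIINegative

local notation "ℝ³" => EuclideanSpace ℝ (Fin 3)

/-! ## §0 Probes: the crux elaborates; the shared copies are the same term -/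

/-- The crux elaborates and is verbatim the `NoTypeII` of route `SqueezeCycle`. [folklore] -/
theorem typeIliouvilleNoTypeII_iff_squeezeCycle :
    TypeILiouville.TypeIliouvilleNoTypeII ↔ SqueezeCycle.NoTypeII := Iff.rfl

/-- … and verbatim the `NoTypeII` of route `TypeICertificateLadder` (whose bridge file
`TypeICertificateLadderNoTypeIIBridge` gives the Seregin dictionary). [folklore] -/
theorem typeIliouvilleNoTypeII_iff_ladder :
    TypeILiouville.TypeIliouvilleNoTypeII ↔ TypeICertificateLadder.NoTypeII := Iff.rfl

/-! ## §a Load-bearing analysis (landed: `Negative/WithoutLerayHopfFalse.lean`, p136424) -/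

/-- **`0 < T` is redundant**: a maximal smooth solution has positive lifespan (landed as
`TypeIliouvilleNoTypeIINegative.pos_of_isMaximalSmoothSolution`). [folklore] -/
theorem hyp_pos_redundant {ν T : ℝ} {u : ℝ → ℝ³ → ℝ³} {p : ℝ → ℝ³ → ℝ}
    (h : IsMaximalSmoothSolution ν 0 u p T) : 0 < T :=
  pos_of_isMaximalSmoothSolution h

/-- The crux with the Leray–Hopf (finite-energy) hypothesis deleted. -/
def TypeIliouvilleNoTypeIIWithoutLerayHopf : Prop :=
  ∀ (ν T : ℝ), 0 < ν → 0 < T → ∀ (u : ℝ → ℝ³ → ℝ³) (p : ℝ → ℝ³ → ℝ),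
    IsMaximalSmoothSolution ν 0 u p T → HasRapidSpatialDecay (u 0) → IsTypeIBlowup u T

/-- **(a) Finite energy is load-bearing.**  `TypeIliouvilleNoTypeII` with `IsLerayHopfOn`
deleted is FALSE: the Type-II drift `u = g(t)·e₁`, `p = −g′(t) x₁`, `g(t) = (1 − t)⁻¹ − 1`
(`ν = T = 1`) is a maximal smooth solution from the rapidly decaying datum `0`
(`drift_gII_isMaximalSmoothSolution`, `drift_rapidDecay`) which is not Type I
(`drift_gII_not_isTypeIBlowup`).  Landed theorem
`TypeIliouvilleNoTypeIINegative.typeIliouvilleNoTypeII_false_without_lerayHopf`.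
[cite: KochNadirashviliSereginSverak2009, §1 p. 3 (parasitic solutions)] -/
theorem typeIliouvilleNoTypeII_false_without_lerayHopf : ¬ TypeIliouvilleNoTypeIIWithoutLerayHopf :=
  TypeIliouvilleNoTypeIINegative.typeIliouvilleNoTypeII_false_without_lerayHopf

/-- The witness is robust: the SAME drift kills every member of the rate family of §b with the
energy class deleted and exponent `α < 1` (here the Type-I member suffices for the crux; for
`α ≥ 1` use `g(t) = (1 − t)^{-2} − 1`, not formalised).  Recorded instance: the drift is a maximal
smooth solution for EVERY viscosity `ν` (it does not see `ν`: `Δu = 0`). [folklore] -/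
theorem drift_gII_isMaximalSmoothSolution_all (ν : ℝ) :
    IsMaximalSmoothSolution ν 0 (drift fun s : ℝ => (1 - s)⁻¹ - 1)
      (driftP fun s : ℝ => (1 - s)⁻¹ - 1) 1 :=
  drift_gII_isMaximalSmoothSolution ν

/-! ## §b Tightness: the exponent `1/2`, and the harmless strengthenings
(landed: `Negative/RateTightness.lean`, p136475) -/

/-- The crux with blow-up exponent `α`: `‖u(t, x)‖ ≤ C (T − t)^{-α}` for all `x` and all
`t < T` near `T`.  `α = 1/2` is the crux (`noBlowupRate_half_iff`). -/
def NoBlowupRate (α : ℝ) : Prop :=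
  ∀ (ν T : ℝ), 0 < ν → 0 < T → ∀ (u : ℝ → ℝ³ → ℝ³) (p : ℝ → ℝ³ → ℝ),
    IsMaximalSmoothSolution ν 0 u p T → IsLerayHopfOn T ν 0 (u 0) u →
    HasRapidSpatialDecay (u 0) → ∃ C : ℝ, ∀ᶠ t in 𝓝[<] T, ∀ x, ‖u t x‖ ≤ C / (T - t) ^ α

/-- "No finite-energy blow-up from Schwartz data": no maximal smooth solution with finite lifespan
is Leray–Hopf from a rapidly decaying datum — the thesis X of the no-blow-up routes
(`noBlowup_iff_thesis`). -/
def NoBlowup : Prop :=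
  ∀ (ν T : ℝ), 0 < ν → 0 < T → ∀ (u : ℝ → ℝ³ → ℝ³) (p : ℝ → ℝ³ → ℝ),
    IsLerayHopfOn T ν 0 (u 0) u → HasRapidSpatialDecay (u 0) → ¬ IsMaximalSmoothSolution ν 0 u p T

/-- `NoBlowup` is the route's thesis `TypeIliouvilleThesis` (X), reshuffled. [folklore] -/
theorem noBlowup_iff_thesis : NoBlowup ↔ TypeILiouville.TypeIliouvilleThesis := by
  constructor
  · intro h ν T hν hT u p hcl hLH hdec
    by_contra hext
    exact h ν T hν hT u p hLH hdec ⟨hcl, hext⟩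
  · intro h ν T hν hT u p hLH hdec hmax
    exact hmax.2 (h ν T hν hT u p hmax.1 hLH hdec)

/-- `α = 1/2` is the crux (`x ^ (1/2) = √x`; landed `typeIliouvilleNoTypeII_iff_noBlowupRate_half`).
[folklore] -/
theorem noBlowupRate_half_iff : NoBlowupRate (1 / 2) ↔ TypeILiouville.TypeIliouvilleNoTypeII :=
  typeIliouvilleNoTypeII_iff_noBlowupRate_half.symm

/-- The rate family is monotone (landed `noBlowupRate_mono`). [folklore] -/
theorem NoBlowupRate.mono {α β : ℝ} (hαβ : α ≤ β) (h : NoBlowupRate α) : NoBlowupRate β :=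
  noBlowupRate_mono hαβ h

/-- **(b) The exponent `1/2` is sharp downwards** (landed `noBlowup_of_noBlowupRate_lt_half`,
`noBlowupRate_of_noBlowup`): for `α < 1/2`, `NoBlowupRate α ↔ NoBlowup`.
[cite: Leray1934, §19 (3.8)–(3.9) p. 224] -/
theorem noBlowupRate_iff_noBlowup_of_lt_half {α : ℝ} (hα : α < 1 / 2) :
    NoBlowupRate α ↔ NoBlowup :=
  ⟨noBlowup_of_noBlowupRate_lt_half hα, noBlowupRate_of_noBlowup α⟩

/-- Hence below `1/2` every member of the family is the thesis X itself. [folklore] -/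
theorem noBlowupRate_iff_thesis_of_lt_half {α : ℝ} (hα : α < 1 / 2) :
    NoBlowupRate α ↔ TypeILiouville.TypeIliouvilleThesis :=
  (noBlowupRate_iff_noBlowup_of_lt_half hα).trans noBlowup_iff_thesis

/-- **The "all times" strengthening is harmless** (landed `forall_Ico_of_typeIliouvilleNoTypeII`;
the converse is restriction to the eventual filter). [cite: Tao2011, Cor. 11.1 + Cor. 4.3 + Thm. 5.4 (iv)] -/
theorem noTypeII_iff_allTimes :
    TypeILiouville.TypeIliouvilleNoTypeII ↔
      ∀ (ν T : ℝ), 0 < ν → 0 < T → ∀ (u : ℝ → ℝ³ → ℝ³) (p : ℝ → ℝ³ → ℝ),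
        IsMaximalSmoothSolution ν 0 u p T → IsLerayHopfOn T ν 0 (u 0) u →
        HasRapidSpatialDecay (u 0) →
        ∃ C : ℝ, ∀ t ∈ Ico 0 T, ∀ x, ‖u t x‖ ≤ C / Real.sqrt (T - t) := by
  refine ⟨forall_Ico_of_typeIliouvilleNoTypeII, fun h ν T hν hT u p hmax hLH hdec => ?_⟩
  obtain ⟨C, hC⟩ := h ν T hν hT u p hmax hLH hdec
  exact ⟨C, by
    filter_upwards [Ico_mem_nhdsLT hT] with t ht
    exact hC t ht⟩

/-! ## §c Conditional kill: one axisymmetric blow-up refutes the crux (not landed, see header) -/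

/-- **Hou's scenario, typed**: SOME finite-energy classical solution from a rapidly decaying datum,
axisymmetric on `[0, T)`, has finite classical lifespan `T` (a maximal smooth solution).  Not
known to hold (it is a negative answer to Clay (A)); Hou 2022 (arXiv:2107.06509) is numerical
evidence for it. -/
def AxisymmetricBlowupExists : Prop :=
  ∃ (ν T : ℝ) (u : ℝ → ℝ³ → ℝ³) (p : ℝ → ℝ³ → ℝ), 0 < ν ∧ 0 < T ∧
    IsMaximalSmoothSolution ν 0 u p T ∧ IsLerayHopfOn T ν 0 (u 0) u ∧
    HasRapidSpatialDecay (u 0) ∧ ∀ t ∈ Ico 0 T, IsAxisymmetric (u t)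

/-- **(c) `knss_no_axisymmetric_typeI ∧ AxisymmetricBlowupExists → ¬ crux`.**  Given the
Literature fact "no axisymmetric Type I blow-up" (KNSS 2009, Thms 6.1–6.2 = p. 4 "every potential
singularity of an axi-symmetric solution has to be of type II"; Seregin–Šverák 2009 Thm 1.1) and
ONE axisymmetric finite-energy blow-up from Schwartz data, the crux fails: the crux makes the
blow-up Type I, the solution is bounded on closed sub-slabs (`exists_forall_norm_le_of_tao2011`),
so the KNSS fact continues it past `T`, contradicting maximality.
[cite: KochNadirashviliSereginSverak2009, Thm 6.1 and Thm 6.2 (§6, arXiv numbering)] -/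
theorem typeIliouvilleNoTypeII_false_of_axisymmetricBlowup (hknss : knss_no_axisymmetric_typeI)
    (hHou : AxisymmetricBlowupExists) : ¬ TypeILiouville.TypeIliouvilleNoTypeII := by
  intro h
  obtain ⟨ν, T, u, p, hν, hT, hmax, hLH, hdec, haxi⟩ := hHou
  have hI : IsTypeIBlowup u T := h ν T hν hT u p hmax hLH hdec
  have hslab := exists_forall_norm_le_of_tao2011 tao2011_hasBoundedSobolevNormsOn_holds hν hmax.1
    hLH hdec
  have hbdd : ∀ T' < T, ∃ M : ℝ, ∀ t ∈ Icc 0 T', ∀ x, ‖u t x‖ ≤ M := by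
    intro T₁ hT₁
    obtain ⟨M, hM⟩ := hslab (max T₁ (T / 2)) ⟨lt_max_of_lt_right (by linarith),
      max_lt hT₁ (by linarith)⟩
    exact ⟨M, fun t ht x => hM t ⟨ht.1, ht.2.trans (le_max_left _ _)⟩ x⟩
  exact hmax.2 (hknss hν hT hmax.1 hLH hbdd haxi (Or.inl hI))

/-- The same kill, phrased over ANY symmetry class for which Type I blow-up is excluded: if some
class `P` of maximal Leray–Hopf solutions from Schwartz data is (i) non-empty and (ii) free of
Type I blow-up, the crux fails.  (§c is `P = axisymmetric` with (ii) = KNSS.) [folklore] -/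
theorem typeIliouvilleNoTypeII_false_of_typeIFree_class
    (P : ℝ → ℝ → (ℝ → ℝ³ → ℝ³) → (ℝ → ℝ³ → ℝ) → Prop)
    (hne : ∃ ν T u p, 0 < ν ∧ 0 < T ∧ IsMaximalSmoothSolution ν 0 u p T ∧
      IsLerayHopfOn T ν 0 (u 0) u ∧ HasRapidSpatialDecay (u 0) ∧ P ν T u p)
    (hfree : ∀ ν T u p, 0 < ν → 0 < T → IsMaximalSmoothSolution ν 0 u p T →
      IsLerayHopfOn T ν 0 (u 0) u → HasRapidSpatialDecay (u 0) → P ν T u p → ¬ IsTypeIBlowup u T) :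
    ¬ TypeILiouville.TypeIliouvilleNoTypeII := by
  intro h
  obtain ⟨ν, T, u, p, hν, hT, hmax, hLH, hdec, hP⟩ := hne
  exact hfree ν T u p hν hT hmax hLH hdec hP (h ν T hν hT u p hmax hLH hdec)

/-! ## Notes (prose for the provers; nothing below is used above)

WHY IT RESISTS.  After §a the hypotheses pin `u` down completely: weak–strong uniqueness
(`weak_strong_uniqueness_holds`) identifies `u` with the mild solution from `u 0`, bounded on
`[0, T₁] × ℝ³` for `T₁ < T` and singular at `(T, x₀)`.  No explicit finite-energy classical
Navier–Stokes flow on `ℝ³` with a finite lifespan is known, so EVERY junk-free counterexample is a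
resolution of Clay (A) in the negative; conversely the crux follows from Clay (A) (vacuity).  The
crux is therefore open in both directions.  In print only SCENARIOS of Type II blow-up are excluded
(Seregin arXiv:2606.29468 Thm 2.1 and its refs [4]–[6]); nothing bounds a blow-up rate from above.

HYPOTHESIS MUTATION (cycle 1).  `IsLerayHopfOn`: load-bearing (§a).  `0 < T`: redundant
(`hyp_pos_redundant`).  `0 < ν`: no witness — for `ν = 0` the statement is the (open) Type-I
question for smooth Euler blow-up from Schwartz data (Elgindi's blow-up is `C^{1,α}`, Chen–Hou's has
a boundary); for `ν < 0` (backward heat) blow-up is generic but no explicit finite-energy NS flow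
exhibits it.  `HasRapidSpatialDecay (u 0)`: no witness — `u 0` is smooth and `L²` anyway (classical
at `t = 0`, `memLp`), and finite-energy blow-up from such data is as open as Clay (A).
Maximality: without it the conclusion asks a Type-I bound of a solution that extends classically
past `T`; morally true (bounded near `T` by uniqueness) — not attackable.  Which FIELD of
`IsLerayHopfOn` is load-bearing: the drift with an `L²(0,1)` amplitude is even a weak solution up to
`T = 1` (`drift_isWeakNSSolutionOn`), so it is the finite-ENERGY fields (`memLp`, `energy_bound`),
not the weak formulation; a Type-II drift with `∫₀¹ g² < ∞` needs a spiky amplitude (sparse bumps of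
height `2^k` and width `8^{-k}` at `t_k = 1 − 2^{-k}`) — not formalised this cycle (candidate for a
later `_false_with_weak_only` lemma).

STRENGTHENINGS.  Exponent `α < 1/2`: collapses to Clay (A) (§b).  Bound on all of `[0,T)`:
equivalent (§b).  Uniform constant `C = C₀√ν` for all solutions: open, not attackable (needs a
blow-up).  Small constant `C < c√ν`: excluded by `typeICertificateLadder_rungZero` (tree).

MODEL EQUATIONS WHERE THE ANALOGUE FAILS (barriers): Tao's averaged NS blow-up is Type II
(`Literature.Barriers.NavierStokesRegularity.TaoAveragedBlowup`; arXiv:1402.0290 p. 8 fn.); the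
truncated dyadic model blow-up is Type II (`TruncatedDyadicBlowup.critical_blowup`); and the tree's
perpetual pump (`PerpetualPumpThesisRefutation`) is an averaged TYPE-I blow-up.  So no
averaging-blind / energy-level argument proves the crux, and none refutes it either.

LINE `Sketch` (PICKED.md 2026-08-17T01:29Z, immortal-zoom composition; `Lines/Sketch.lean`,
6 stubs) — cheap stub-by-stub attack, cycle 1, NO KILL, no misstatement found:
* `stub_timeDoubling` — true as stated (PQS 2007 Lemma 5.1 on `X = [a, T]` with the parabolic
  metric `√|s − t|`; the extra clauses `a < t − k²/m(t)²`, `t₁ < t` follow by starting the PQS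
  iteration at `y₀ > (max a t₁ + T)/2` with `m(y₀)√(T − y₀) > K`, `K² > 6k²`: the iterates drift
  left by at most `2k²/m(y₀)² < (T − max a t₁)/3`).  Degenerate `T ≤ a`: `hunb` is then false,
  stub vacuous — fine.
* `stub_supNorm` — true over the tree (`continuousInLpOn_top_slab_of_classical` gives
  `u ∈ C([0,T₁]; L^∞)`, sup = ess-sup for continuous slices, `leray_blowup_rate_top_holds` gives
  `c√ν/√(T − t) ≤ ‖u(t)‖_∞` on `Ico 0 T`).  Note the Leray clause makes `m > 0`, which the glue
  needs for `stub_timeDoubling`'s `hpos`.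
* `stub_activeWindowsGenerateNonconstant` — no cheap kill: parabolic regularity of bounded mild
  solutions gives `ν‖∇u(t)‖ ≤ C_univ M²` on windows with `k ≥ 1`, so `hwin` with `ε > C_univ` is
  unsatisfiable and the stub vacuous there — consistent, not a refutation; two-sidedness makes the
  centre interior, so `C¹` convergence at `(0,0)` is legitimate.
* `stub_windowActivity` (residual, open) — vacuous for Type-I blow-ups once `k₀ > 4C²/ν`; content
  = "no depleted Type-II blow-up"; FALSE for Tao's averaged cascade (card's own computation), so
  only fine-structure proofs can reach it; not attackable without a blow-up.
* `stub_eternalLiouville` (residual, open) — the parasitic family does NOT kill it: a spatially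
  constant eternal field `v(t, ·) = b(t)` satisfies the Oseen-mild identity only if `b` is constant
  (`oseenDuhamel_eq_zero_of_const` + `heatFlow` of a constant; = KNSS Rem. 6.1, tree file
  `KNSSRemark61.lean`), and then `∇v = 0`.  Beltrami/Oseen/Kolmogorov flows are unbounded as
  `t → −∞`, Landau is singular, 2½-D bounded eternal flows are constant (KNSS Thm 5.1 + heat
  Liouville).  A non-constant bounded STEADY flow on `ℝ³` would kill it (open, KNSS p. 9).
* `stub_eternalLiouville_of_liouvilleConjecture` — bookkeeping, plausible.
* Joint sufficiency: the glue `TypeIliouvilleNoTypeII_of_eternalLiouville` is sorry-free in the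
  skeleton; nothing is smuggled (the open content is exactly stubs 4 and 5, as PICKED.md says).

OTHER IDEAS (round 1): `LiouvilleForcesDepletion` (viscous-activity-ratio; conditional on (L), not
attackable cheaply; its residual `NoDepletedBlowup` is false for Tao's averaged cascade, as the
card computes); `ThreeFifthsLaw` (gradient-bkm-pivot; a kinematic interpolation
`‖u‖_∞ ≤ C‖u‖₂^{2/5}‖curl u‖_∞^{3/5}`, dimensionally consistent (`[L T⁻¹] = [L^{5/2}T⁻¹]^{2/5}[T⁻¹]^{3/5}`),
true by local Biot–Savart; no kill).
-/

end Summit.NavierStokesRegularity.NavierStokesRegularity.Cruxes.TypeIliouvilleNoTypeII.Disproof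

end
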